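import Literature.MathematicalPhysics.QuantumFieldTheory.Balaban1983to89.B6Partition118KLevelTorusCentralL0
import Literature.MathematicalPhysics.QuantumFieldTheory.Balaban1983to89.B6Partition118KLevelTorusCentralAt
/-!
# `Balaban1983to89.B6Partition118KLevelTorusCentralAtL0` — LEVEL-0 TWIN (programme G-F3′-L0, director-ym LINE №27 / UV3-NODE §24.5; plan `lit-balaban-r03/G-F3L0-PLAN.md`) of `B6Partition118KLevelTorusCentralAt`:
the same declarations, SAME NAMES AND STATEMENTS, for nested families WITH print's region `Λ₀ = T ∖ Ω₁` ADMITTED (structures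
`B6MultiLevelBoxOperatorL0.Domains` / `B6MultiLevelTorusOperatorL0.TDomains`: levels `0, …, k`, the level-`0` block a single site, `Q′₀ = id`,
finite weight `a₀` — print p.225 (2.14) «Σ_{j=0}^k … (Q′₀λ)(x) = λ(x), x ∈ Λ₀», p.229 «taking a sequence (2.1) … smallest possible domains B^j(Λ_j),
and considering the operator Δ_a defined by (2.19), (2.20) for this sequence»).  Every `D`-free object is the lineage's, consumed BY NAME; no existing
module is touched; no fact is minted.  Unit `lit-balaban-r03` (B6 fold owner, r03 gen 36); referee ref-4.  THE TWIN'S DOCUMENTATION FOLLOWS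
VERBATIM (its «levels 1 … k» / «Ω₁ = X» sentences describe the twin; here `j` runs from `0` and `Ω₁` may be a proper subset).

# `Balaban1983to89.B6Partition118KLevelTorusCentralAt` — T. Bałaban, *Propagators and renormalization transformations for lattice gauge theories. II*,
# Commun. Math. Phys. **96** (1984) 223–250 [Balaban1984PropagatorsII], (2.36) p. 229, (2.2) p. 224, p. 238 (the member torus `T_□` of an enlarged cube):
# THE CANONICAL CHART OF A TORUS CUBE AT AN ARBITRARY TOP-BLOCK INDEX `t₀` — the `t₀`-parametric twin of `…B6Partition118KLevelTorusCentral` (index `2`)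
# and `…B6Partition118KLevelTorusWindow`: centre bounds `t₀·S_k + S/2 ≤ ctr_μ ≤ N₀_μ − (P_μ − t₀ − 1)·S_k − S/2`, the dictionary `hT = hF ∘ σ⁻¹` in that
# chart, the two-level window and the depth of a ball of ANY radius around the cube (the room a member window of half-period `L·S_k` needs below a top cube)

statement-level skeleton of published theorems with citation tags; proofs where landed; nothing here is a claim about the Yang–Mills mass gap

PDF held: `paper:balaban1984-cmp96-propagators-rt-ii` (journal page = PDF page + 222): p. 224 [PDF 2] ((2.1)–(2.2)), p. 229 [PDF 7] ((2.36)), p. 238 [PDF 16]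
(*"We take the cube □̃³ and identify it with a torus, denoted by T_□"*); read from the tree transcriptions in `…B6Partition118KLevelTorusCentral` / `…Window`
(p38 gen 26) and `…B6Eq238MultiLevelTorus` (p21).

CITATION HEADER (lean-in-tree rule) — WHAT IS REPRODUCED.  Phase-2 file of the `lit-balaban` typed skeleton (HOME `run/shared/lean/pub/lit-balaban/`), seat
**p38 gen 27**; owner r03's ask (B6-CLOSURE §5 item 13 (iii)/(iv), seat INBOX 2026-08-23T04:28:56Z: *"for a top-level cube (j = k) the member window has
half-period L·S_k and corner ≈ ctr − L·S_k/2, so the central cube must sit at big-block index t₀ ≥ L, not 2"*); SKELETON rows **B6.Eq2.36** × **B6.Eq2.2** ×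
**B6.Eq2.134** (cells only; decls of record untouched; referee ref-4).  Gen 26 fixed p21's chart `svec ℓ k j β` (top big block of index `2`); THIS FILE repeats
§1 of `…Central` and §§1–2 of `…Window` VERBATIM IN SHAPE for the chart `svecAt t₀ j β := β/L^{k−j} − t₀` with central label `qcAt t₀ j β := β mod L^{k−j} +
t₀L^{k−j}` (top big block of index `t₀`), under `1 ≤ t₀`, `t₀ + 2 ≤ P_μ`:
* §1 `svecAt`, `qcAt`, `q_eq_qcAt_add`, `qcAt_bounds_rj`; the chart family `DchAt`, translation `σchAt`, central cube `ccAt` (`cTinv_svecAt_eq`, `ccAt_mem`,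
  `cubesEquiv_ccAt`, `side_ccAt`), **`ctr_ccAt_bounds`**: `t₀·S_k + S/2 ≤ ctr_μ` and `ctr_μ + (P_μ − t₀ − 1)·S_k + S/2 ≤ N₀_μ`, `ctrDeep_ccAt`, the dictionary
  **`hT_eq_hF_ccAt`** / `hT_eq_pullT_At`, `lev_blkOf_σchAt`;
* §2 the radius-parametric two-level window `two_level_ball_At` (`(ρ + S/2)·L ≤ R·S ⟹ ∃ j₀ ∈ {j − 1, j}`, chart levels in `{j₀, j₀ + 1}` on the `ρ`-ball) and
  the depth `siteDeep_of_dist_le_of_room_At` / `blkDeep_of_room_At` (room `ρ + w ≤ t₀S_k + S/2` below, `≤ (P_μ − t₀ − 1)S_k + S/2` above).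
No `def : Prop`, no new fact; defs with bodies (`svecAt`, `qcAt`, `DchAt`, `σchAt`, `ccAt`); standard axioms.
HONEST SCOPE / DIVERGENCES. As `…Central`/`…Window` (the chart is one admissible choice; `…Chart`'s dictionary serves any `CtrDeep` cube; integer torus;
constants `L`, `d`-dependent); the torus-metric binders of `…Binders` are chart-free statements and are NOT repeated.  Nothing on d = 4 or the continuum; NOT
summit progress.  Unit `lit-balaban-p38` (gen 27), 2026-08-23.
-/

namespace Literature.MathematicalPhysics.QuantumFieldTheory.Balaban1983to89.B6Partition118KLevelTorusCentralAtL0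

open Finset
open Literature.MathematicalPhysics.QuantumFieldTheory.Balaban1983to89.B4Reflection242 (boxDom mem_boxDom blk)
open Literature.MathematicalPhysics.QuantumFieldTheory.Balaban1983to89.B4ContourShift (supNorm)
open Literature.MathematicalPhysics.QuantumFieldTheory.Balaban1983to89.B6MultiLevelBoxOperator (N0 bigSide bigSide_eq bigSide_succ one_le_bigSide)
open Literature.MathematicalPhysics.QuantumFieldTheory.Balaban1983to89.B6MultiLevelBoxOperatorL0 (Domains)
open Literature.MathematicalPhysics.QuantumFieldTheory.Balaban1983to89.B6MultiLevelTorusOperator (twrap_eq_self tshift)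
open Literature.MathematicalPhysics.QuantumFieldTheory.Balaban1983to89.B6MultiLevelTorusOperatorL0 (TDomains)
open Literature.MathematicalPhysics.QuantumFieldTheory.Balaban1983to89.B6Geom246MultiLevelBox (toR supNorm_eq_dist)
open Literature.MathematicalPhysics.QuantumFieldTheory.Balaban1983to89.B6Geom246MultiLevelBoxL0 (bset blkOf cen)
open Literature.MathematicalPhysics.QuantumFieldTheory.Balaban1983to89.B6Cover236MultiLevelBlocksL0 (cubes side side_eq side_pos ctr wit lev_wit blk_wit dist_toR_ctr_le)
open Literature.MathematicalPhysics.QuantumFieldTheory.Balaban1983to89.B6Eq238MultiLevelBox (Pj)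
open Literature.MathematicalPhysics.QuantumFieldTheory.Balaban1983to89.B6Eq238MultiLevelTorus (rj one_le_rj bigSide_k_eq N0_eq_mul_Pj Pj_eq)
open Literature.MathematicalPhysics.QuantumFieldTheory.Balaban1983to89.B6Partition118KLevelFineL0 (hF)
open Literature.MathematicalPhysics.QuantumFieldTheory.Balaban1983to89.B6TorusDepthDistance (SiteDeep)
open Literature.MathematicalPhysics.QuantumFieldTheory.Balaban1983to89.B6TorusDepthDistanceL0 (BlkDeep pullT pullT_apply)
open Literature.MathematicalPhysics.QuantumFieldTheory.Balaban1983to89.B6Partition118KLevelTorusL0 (hT)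
open Literature.MathematicalPhysics.QuantumFieldTheory.Balaban1983to89.B6Partition118KLevelTorusChart (cT cTinv)
open Literature.MathematicalPhysics.QuantumFieldTheory.Balaban1983to89.B6Partition118KLevelTorusChartL0 (cTinv_mem cT_cTinv cubesEquiv cubesEquiv_apply_val CtrDeep hT_eq_hF_chart_symm side_le_bigSide_k)
open Literature.MathematicalPhysics.QuantumFieldTheory.Balaban1983to89.B6Partition118KLevelTorusCentralL0 (level_bounds)
open Literature.MathematicalPhysics.QuantumFieldTheory.Balaban1983to89.B6Partition118KLevelTorusCentralAt (svecAt qcAt q_eq_qcAt_add qcAt_bounds_rj cTinv_svecAt_eq)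

variable {d : ℕ} (ℓ : ℕ) {Mh : ℕ} (k : ℕ) {R : ℕ} {P : Fin (d + 1) → ℕ}

/-! ## §1  The chart with the top big block of the cube at index `t₀` -/

variable {ℓ k}

section Central

variable (D : TDomains d ℓ Mh k P R)

/-- **THE `t₀`-CHART FAMILY OF THE TORUS CUBE `c = (j, β)`**: the box family of the chart `svecAt t₀ j β`. [cite: Balaban1984PropagatorsII, (2.1)–(2.2) p.224, dictionary (charts)] -/
abbrev DchAt (t₀ : ℕ) (c : ↥(cubes D.toDomains)) : Domains d ℓ Mh k P R := (D.chart (svecAt ℓ k t₀ c.1.1 c.1.2)).toDomains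

/-- the `t₀`-chart translation `σ_{c,t₀}` (by `(M·L^k)·svecAt`). [cite: Balaban1984PropagatorsII, p.229, dictionary (charts)] -/
abbrev σchAt (t₀ : ℕ) (c : ↥(cubes D.toDomains)) : ↥(boxDom (N0 ℓ Mh k P)) ≃ ↥(boxDom (N0 ℓ Mh k P)) :=
  tshift (N0 ℓ Mh k P) (B6MultiLevelTorusOperator.TDomains.tvec ℓ Mh k (svecAt ℓ k t₀ c.1.1 c.1.2))

variable {D}

/-- the central label is a cube of the `t₀`-chart family. [cite: Balaban1984PropagatorsII, (2.36) p.229, dictionary (charts)] -/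
theorem ccAt_mem (hMh : 1 ≤ Mh) {t₀ : ℕ} (hP : ∀ μ, t₀ + 1 ≤ P μ) (c : ↥(cubes D.toDomains)) :
    (c.1.1, qcAt ℓ k t₀ c.1.1 c.1.2) ∈ cubes (DchAt D t₀ c) := by
  rw [← cTinv_svecAt_eq hP c.1]
  exact cTinv_mem hMh (fun μ => le_trans (by omega) (hP μ)) _ c.2

variable (D)

/-- **THE CENTRAL CUBE `(j, qcAt)`** of the torus cube `c` in its `t₀`-chart. [cite: Balaban1984PropagatorsII, (2.36) p.229, dictionary (charts)] -/
def ccAt (hMh : 1 ≤ Mh) {t₀ : ℕ} (hP : ∀ μ, t₀ + 1 ≤ P μ) (c : ↥(cubes D.toDomains)) : ↥(cubes (DchAt D t₀ c)) :=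
  ⟨(c.1.1, qcAt ℓ k t₀ c.1.1 c.1.2), ccAt_mem hMh hP c⟩

variable {D}

/-- the central cube transports back to `c`. [cite: Balaban1984PropagatorsII, (2.36) p.229, dictionary (charts)] -/
theorem cubesEquiv_ccAt (hMh : 1 ≤ Mh) {t₀ : ℕ} (hP : ∀ μ, t₀ + 1 ≤ P μ) (c : ↥(cubes D.toDomains)) :
    cubesEquiv D hMh (fun μ => le_trans (by omega) (hP μ)) (svecAt ℓ k t₀ c.1.1 c.1.2) (ccAt D hMh hP c) = c := by
  apply Subtype.ext
  rw [cubesEquiv_apply_val]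
  show cT ℓ k P (svecAt ℓ k t₀ c.1.1 c.1.2) (c.1.1, qcAt ℓ k t₀ c.1.1 c.1.2) = c.1
  rw [← cTinv_svecAt_eq hP c.1]
  exact cT_cTinv hMh _ c.2

/-- the side of the central cube is `S_j`. [cite: Balaban1984PropagatorsII, p.229, bookkeeping] -/
theorem side_ccAt (hMh : 1 ≤ Mh) {t₀ : ℕ} (hP : ∀ μ, t₀ + 1 ≤ P μ) (c : ↥(cubes D.toDomains)) :
    side (DchAt D t₀ c) (ccAt D hMh hP c) = (bigSide ℓ Mh c.1.1 : ℝ) := rfl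

/-- **THE CENTRE BOUNDS AT INDEX `t₀`**: `t₀·S_k + S/2 ≤ ctr_μ` and `ctr_μ + (P_μ − t₀ − 1)·S_k + S/2 ≤ N₀_μ` (`S = S_j`, `S_k = M·L^k`) — the room below and
above the cube that a member window needs. [cite: Balaban1984PropagatorsII, p.229, p.238 («the cube □̃³ … a torus T_□»), dictionary (charts)] -/
theorem ctr_ccAt_bounds (hMh : 1 ≤ Mh) {t₀ : ℕ} (hP : ∀ μ, t₀ + 1 ≤ P μ) (c : ↥(cubes D.toDomains)) (μ : Fin (d + 1)) :
    (t₀ : ℝ) * (bigSide ℓ Mh k : ℝ) + (bigSide ℓ Mh c.1.1 : ℝ) / 2 ≤ ctr (DchAt D t₀ c) (ccAt D hMh hP c) μ ∧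
      ctr (DchAt D t₀ c) (ccAt D hMh hP c) μ + ((P μ : ℝ) - t₀ - 1) * (bigSide ℓ Mh k : ℝ) + (bigSide ℓ Mh c.1.1 : ℝ) / 2 ≤ N0 ℓ Mh k P μ := by
  have hjk : c.1.1 ≤ k := (level_bounds D.toDomains c).2
  obtain ⟨h0, h1⟩ := qcAt_bounds_rj (ℓ := ℓ) (k := k) t₀ c.1.1 c.1.2 μ
  have h0r : (t₀ : ℝ) * (rj ℓ k c.1.1 : ℝ) ≤ (qcAt ℓ k t₀ c.1.1 c.1.2 μ : ℝ) := by exact_mod_cast h0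
  have h1r : (qcAt ℓ k t₀ c.1.1 c.1.2 μ : ℝ) + 1 ≤ ((t₀ : ℝ) + 1) * (rj ℓ k c.1.1 : ℝ) := by exact_mod_cast h1
  have eSk : (bigSide ℓ Mh k : ℝ) = (bigSide ℓ Mh c.1.1 : ℝ) * (rj ℓ k c.1.1 : ℝ) := by
    rw [bigSide_k_eq (ℓ := ℓ) (Mh := Mh) hjk, bigSide_eq]; push_cast; ring
  have eN : (N0 ℓ Mh k P μ : ℝ) = (bigSide ℓ Mh c.1.1 : ℝ) * (rj ℓ k c.1.1 : ℝ) * (P μ : ℝ) := by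
    rw [N0_eq_mul_Pj hjk μ, bigSide_eq, Pj_eq]; push_cast; ring
  have ec : ctr (DchAt D t₀ c) (ccAt D hMh hP c) μ = ((qcAt ℓ k t₀ c.1.1 c.1.2 μ : ℝ) + 1 / 2) * (bigSide ℓ Mh c.1.1 : ℝ) := rfl
  have hS : (0 : ℝ) ≤ (bigSide ℓ Mh c.1.1 : ℝ) := by positivity
  rw [ec, eSk, eN]
  constructor <;> nlinarith

/-- **THE CENTRAL CUBE IS `CtrDeep`** for `1 ≤ t₀`, `t₀ + 2 ≤ P_μ`. [cite: Balaban1984PropagatorsII, p.229, dictionary (charts)] -/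
theorem ctrDeep_ccAt (hMh : 1 ≤ Mh) {t₀ : ℕ} (ht₀ : 1 ≤ t₀) (hP2 : ∀ μ, t₀ + 2 ≤ P μ) {hP : ∀ μ, t₀ + 1 ≤ P μ} (c : ↥(cubes D.toDomains)) :
    CtrDeep (DchAt D t₀ c) (ccAt D hMh hP c) := by
  intro μ
  obtain ⟨h1, h2⟩ := ctr_ccAt_bounds hMh hP c μ
  have hPr : (t₀ : ℝ) + 2 ≤ P μ := by exact_mod_cast hP2 μ
  have ht : (1 : ℝ) ≤ t₀ := by exact_mod_cast ht₀
  have hS : side (DchAt D t₀ c) (ccAt D hMh hP c) ≤ (bigSide ℓ Mh k : ℝ) := side_le_bigSide_k _ _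
  rw [side_ccAt] at hS ⊢
  have hSk : (0 : ℝ) ≤ (bigSide ℓ Mh k : ℝ) := by positivity
  constructor <;> nlinarith

/-- **`h^T_c` READ IN THE `t₀`-CHART**: `hT D c z = hF (DchAt D t₀ c) (ccAt c) (σ_{c,t₀}⁻¹ z)` (`1 ≤ t₀`, `t₀ + 2 ≤ P_μ`).
[cite: Balaban1984PropagatorsII, (2.36) p.229, dictionary (charts)] -/
theorem hT_eq_hF_ccAt (hMh : 1 ≤ Mh) {t₀ : ℕ} (ht₀ : 1 ≤ t₀) (hP2 : ∀ μ, t₀ + 2 ≤ P μ) {hP : ∀ μ, t₀ + 1 ≤ P μ} (c : ↥(cubes D.toDomains))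
    (z : ↥(boxDom (N0 ℓ Mh k P))) :
    hT D c z = hF (DchAt D t₀ c) (ccAt D hMh hP c) ((σchAt D t₀ c).symm z) := by
  have hP2' : ∀ μ, 2 ≤ P μ := fun μ => le_trans (by omega) (hP2 μ)
  have h := hT_eq_hF_chart_symm (D := D) hMh hP2' (svecAt ℓ k t₀ c.1.1 c.1.2) (ccAt D hMh hP c) (ctrDeep_ccAt hMh ht₀ hP2 c) z
  have e : cubesEquiv D hMh (fun μ => le_trans (by norm_num) (hP2' μ)) (svecAt ℓ k t₀ c.1.1 c.1.2) (ccAt D hMh hP c) = c :=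
    cubesEquiv_ccAt hMh hP c
  rw [e] at h
  exact h

/-- the same as `hT D c = pullT (svecAt …) (hF (DchAt D t₀ c) (ccAt c))`. [cite: Balaban1984PropagatorsII, (2.36) p.229, dictionary (charts)] -/
theorem hT_eq_pullT_At (hMh : 1 ≤ Mh) {t₀ : ℕ} (ht₀ : 1 ≤ t₀) (hP2 : ∀ μ, t₀ + 2 ≤ P μ) {hP : ∀ μ, t₀ + 1 ≤ P μ} (c : ↥(cubes D.toDomains)) :
    hT D c = pullT (svecAt ℓ k t₀ c.1.1 c.1.2) (hF (DchAt D t₀ c) (ccAt D hMh hP c)) :=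
  funext fun z => by rw [pullT_apply]; exact hT_eq_hF_ccAt hMh ht₀ hP2 c z

/-- the torus level of `σ_{c,t₀} x` is the chart level of `x`. [cite: Balaban1984PropagatorsII, (2.3)–(2.4) p.224, dictionary (charts)] -/
theorem lev_blkOf_σchAt (t₀ : ℕ) (c : ↥(cubes D.toDomains)) (x : ↥(boxDom (N0 ℓ Mh k P))) :
    (blkOf D.toDomains (σchAt D t₀ c x)).1.1 = (blkOf (DchAt D t₀ c) x).1.1 := by
  show D.lev (σchAt D t₀ c x).1 = (D.chart (svecAt ℓ k t₀ c.1.1 c.1.2)).lev x.1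
  rw [D.chart_lev]

end Central

/-! ## §2  The two-level window and the depth of a ball around the cube, in the `t₀`-chart -/

section Window

variable {D : TDomains d ℓ Mh k P R}

/-- a chart site within `ρ` of the centre of the central cube is within `ρ + S_j/2` (sup norm) of the cube's witness.
[cite: Balaban1984PropagatorsII, p.229 («with a center y ∈ Λ_j»), bookkeeping] -/
theorem supNorm_sub_wit_le_At (hMh : 1 ≤ Mh) {t₀ : ℕ} (hP : ∀ μ, t₀ + 1 ≤ P μ) (c : ↥(cubes D.toDomains)) {ρ : ℝ} {w : ↥(boxDom (N0 ℓ Mh k P))}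
    (hw : dist (toR w.1) (ctr (DchAt D t₀ c) (ccAt D hMh hP c)) ≤ ρ) :
    supNorm (w.1 - (wit (DchAt D t₀ c) (ccAt D hMh hP c)).1) ≤ ρ + (bigSide ℓ Mh c.1.1 : ℝ) / 2 := by
  have hwit : dist (toR (wit (DchAt D t₀ c) (ccAt D hMh hP c)).1) (ctr (DchAt D t₀ c) (ccAt D hMh hP c)) ≤ (bigSide ℓ Mh c.1.1 : ℝ) / 2 := by
    rw [← side_ccAt hMh hP c]; exact dist_toR_ctr_le (DchAt D t₀ c) hMh (blk_wit (DchAt D t₀ c) (ccAt D hMh hP c))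
  rw [supNorm_eq_dist]
  linarith [dist_triangle_right (toR w.1) (toR (wit (DchAt D t₀ c) (ccAt D hMh hP c)).1) (ctr (DchAt D t₀ c) (ccAt D hMh hP c))]

/-- levels `≥ j − 1` on the `ρ`-ball: `(ρ + S_j/2)·L ≤ R·S_j ⟹ j ≤ lev w + 1`. [cite: Balaban1984PropagatorsII, (2.2) p.224] -/
theorem lev_ge_of_dist_le_At (hMh : 1 ≤ Mh) {t₀ : ℕ} (hP : ∀ μ, t₀ + 1 ≤ P μ) (c : ↥(cubes D.toDomains)) {ρ : ℝ}
    (hρ : (ρ + (bigSide ℓ Mh c.1.1 : ℝ) / 2) * ((ℓ : ℝ) + 1) ≤ (R : ℝ) * (bigSide ℓ Mh c.1.1 : ℝ)) {w : ↥(boxDom (N0 ℓ Mh k P))}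
    (hw : dist (toR w.1) (ctr (DchAt D t₀ c) (ccAt D hMh hP c)) ≤ ρ) : c.1.1 ≤ (DchAt D t₀ c).lev w.1 + 1 := by
  by_contra hlt
  push Not at hlt
  obtain ⟨i, hi⟩ : ∃ i, c.1.1 = i + 1 := ⟨c.1.1 - 1, by omega⟩
  have hlw : (DchAt D t₀ c).lev (wit (DchAt D t₀ c) (ccAt D hMh hP c)).1 = c.1.1 := lev_wit (DchAt D t₀ c) (ccAt D hMh hP c)
  have hsep := (DchAt D t₀ c).sep i w.1 w.2 (wit (DchAt D t₀ c) (ccAt D hMh hP c)).1 (wit (DchAt D t₀ c) (ccAt D hMh hP c)).2 (by omega) (by omega)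
  have hnear := supNorm_sub_wit_le_At hMh hP c hw
  have eS : (bigSide ℓ Mh c.1.1 : ℝ) = ((ℓ : ℝ) + 1) * (bigSide ℓ Mh i : ℝ) := by rw [hi, bigSide_succ]; push_cast; ring
  have e1 : ((R * bigSide ℓ Mh i : ℕ) : ℝ) = (R : ℝ) * (bigSide ℓ Mh i : ℝ) := by push_cast; ring
  rw [e1] at hsep
  rw [eS] at hρ
  have hL : (0 : ℝ) < (ℓ : ℝ) + 1 := by positivity
  have hb : (0 : ℝ) ≤ (bigSide ℓ Mh i : ℝ) := by positivity
  have h1 : ρ + ((ℓ : ℝ) + 1) * (bigSide ℓ Mh i : ℝ) / 2 ≤ (R : ℝ) * (bigSide ℓ Mh i : ℝ) := by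
    have := hρ; nlinarith
  linarith

/-- levels `≤ j + 1` on the `ρ`-ball: `(ρ + S_j/2)·L ≤ R·S_j ⟹ lev w ≤ j + 1`. [cite: Balaban1984PropagatorsII, (2.2) p.224, p.230] -/
theorem lev_le_of_dist_le_At (hMh : 1 ≤ Mh) {t₀ : ℕ} (hP : ∀ μ, t₀ + 1 ≤ P μ) (c : ↥(cubes D.toDomains)) {ρ : ℝ}
    (hρ : (ρ + (bigSide ℓ Mh c.1.1 : ℝ) / 2) * ((ℓ : ℝ) + 1) ≤ (R : ℝ) * (bigSide ℓ Mh c.1.1 : ℝ)) {w : ↥(boxDom (N0 ℓ Mh k P))}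
    (hw : dist (toR w.1) (ctr (DchAt D t₀ c) (ccAt D hMh hP c)) ≤ ρ) : (DchAt D t₀ c).lev w.1 ≤ c.1.1 + 1 := by
  by_contra hlt
  push Not at hlt
  have hlw : (DchAt D t₀ c).lev (wit (DchAt D t₀ c) (ccAt D hMh hP c)).1 = c.1.1 := lev_wit (DchAt D t₀ c) (ccAt D hMh hP c)
  have hsep := (DchAt D t₀ c).sep (c.1.1 + 1) (wit (DchAt D t₀ c) (ccAt D hMh hP c)).1 (wit (DchAt D t₀ c) (ccAt D hMh hP c)).2 w.1 w.2
    (by omega) (by omega)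
  have hnear := supNorm_sub_wit_le_At hMh hP c hw
  have hsym : supNorm ((wit (DchAt D t₀ c) (ccAt D hMh hP c)).1 - w.1) = supNorm (w.1 - (wit (DchAt D t₀ c) (ccAt D hMh hP c)).1) := by
    rw [supNorm_eq_dist, supNorm_eq_dist, dist_comm]
  rw [hsym] at hsep
  have eS : (bigSide ℓ Mh (c.1.1 + 1) : ℝ) = ((ℓ : ℝ) + 1) * (bigSide ℓ Mh c.1.1 : ℝ) := by rw [bigSide_succ]; push_cast; ring
  have e1 : ((R * bigSide ℓ Mh (c.1.1 + 1) : ℕ) : ℝ) = (R : ℝ) * (((ℓ : ℝ) + 1) * (bigSide ℓ Mh c.1.1 : ℝ)) := by rw [← eS]; push_cast; ring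
  rw [e1] at hsep
  have hL : (1 : ℝ) ≤ (ℓ : ℝ) + 1 := by
    have h : (0 : ℝ) ≤ ℓ := by positivity
    linarith
  have hb : (0 : ℝ) ≤ (bigSide ℓ Mh c.1.1 : ℝ) := by positivity
  have hR0 : (0 : ℝ) ≤ (R : ℝ) := by positivity
  have h1 : ρ + (bigSide ℓ Mh c.1.1 : ℝ) / 2 ≤ (R : ℝ) * (bigSide ℓ Mh c.1.1 : ℝ) := by
    have hρ0 : 0 ≤ ρ := le_trans dist_nonneg hw
    nlinarith
  have h2 : (R : ℝ) * (bigSide ℓ Mh c.1.1 : ℝ) ≤ (R : ℝ) * (((ℓ : ℝ) + 1) * (bigSide ℓ Mh c.1.1 : ℝ)) := by nlinarith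
  linarith

/-- never both `j − 1` and `j + 1` on the `ρ`-ball ((2.2) at level `j`). [cite: Balaban1984PropagatorsII, (2.2) p.224, p.235] -/
theorem not_both_sides_of_dist_le_At (hℓ : 1 ≤ ℓ) (hMh : 1 ≤ Mh) {t₀ : ℕ} (hP : ∀ μ, t₀ + 1 ≤ P μ) (c : ↥(cubes D.toDomains)) {ρ : ℝ}
    (hρ : (ρ + (bigSide ℓ Mh c.1.1 : ℝ) / 2) * ((ℓ : ℝ) + 1) ≤ (R : ℝ) * (bigSide ℓ Mh c.1.1 : ℝ)) {w w' : ↥(boxDom (N0 ℓ Mh k P))}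
    (hw : dist (toR w.1) (ctr (DchAt D t₀ c) (ccAt D hMh hP c)) ≤ ρ) (hw' : dist (toR w'.1) (ctr (DchAt D t₀ c) (ccAt D hMh hP c)) ≤ ρ)
    (hl : (DchAt D t₀ c).lev w.1 + 1 = c.1.1) (hl' : (DchAt D t₀ c).lev w'.1 = c.1.1 + 1) : False := by
  have hsep := (DchAt D t₀ c).sep c.1.1 w.1 w.2 w'.1 w'.2 (by omega) (by omega)
  have e1 : ((R * bigSide ℓ Mh c.1.1 : ℕ) : ℝ) = (R : ℝ) * (bigSide ℓ Mh c.1.1 : ℝ) := by push_cast; ring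
  rw [e1, supNorm_eq_dist] at hsep
  have htri : dist (toR w.1) (toR w'.1) ≤ 2 * ρ := by
    linarith [dist_triangle_right (toR w.1) (toR w'.1) (ctr (DchAt D t₀ c) (ccAt D hMh hP c))]
  have hL : (2 : ℝ) ≤ (ℓ : ℝ) + 1 := by
    have h : (1 : ℝ) ≤ ℓ := by exact_mod_cast hℓ
    linarith
  have hb : (0 : ℝ) ≤ (bigSide ℓ Mh c.1.1 : ℝ) := by positivity
  have hρ0 : 0 ≤ ρ := le_trans dist_nonneg hw
  nlinarith

/-- **THE TWO-LEVEL WINDOW OF THE `ρ`-BALL IN THE `t₀`-CHART**: `(ρ + S_j/2)·L ≤ R·S_j ⟹ ∃ j₀ ∈ {j − 1, j}`, every chart site within `ρ` of the centre of the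
central cube has chart level `j₀` or `j₀ + 1` (the torus level of `σ_{c,t₀} w` is this chart level, `lev_blkOf_σchAt`).
[cite: Balaban1984PropagatorsII, (2.2) p.224, p.230, p.238 («identify it with a torus T_□»)] -/
theorem two_level_ball_At (hℓ : 1 ≤ ℓ) (hMh : 1 ≤ Mh) {t₀ : ℕ} (hP : ∀ μ, t₀ + 1 ≤ P μ) (c : ↥(cubes D.toDomains)) {ρ : ℝ}
    (hρ : (ρ + (bigSide ℓ Mh c.1.1 : ℝ) / 2) * ((ℓ : ℝ) + 1) ≤ (R : ℝ) * (bigSide ℓ Mh c.1.1 : ℝ)) :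
    ∃ j₀ : ℕ, (j₀ + 1 = c.1.1 ∨ j₀ = c.1.1) ∧ ∀ w : ↥(boxDom (N0 ℓ Mh k P)),
      dist (toR w.1) (ctr (DchAt D t₀ c) (ccAt D hMh hP c)) ≤ ρ → j₀ ≤ (DchAt D t₀ c).lev w.1 ∧ (DchAt D t₀ c).lev w.1 ≤ j₀ + 1 := by
  by_cases hdown : ∃ w₀ : ↥(boxDom (N0 ℓ Mh k P)), dist (toR w₀.1) (ctr (DchAt D t₀ c) (ccAt D hMh hP c)) ≤ ρ ∧ (DchAt D t₀ c).lev w₀.1 + 1 = c.1.1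
  · obtain ⟨w₀, hw₀, hl₀⟩ := hdown
    refine ⟨c.1.1 - 1, Or.inl (by omega), fun w hw => ?_⟩
    have h1 := lev_ge_of_dist_le_At hMh hP c hρ hw
    have hne : (DchAt D t₀ c).lev w.1 ≠ c.1.1 + 1 := fun h => not_both_sides_of_dist_le_At hℓ hMh hP c hρ hw₀ hw hl₀ h
    have h2 := lev_le_of_dist_le_At hMh hP c hρ hw
    constructor <;> omega
  · push Not at hdown
    refine ⟨c.1.1, Or.inr rfl, fun w hw => ?_⟩
    have h1 := lev_ge_of_dist_le_At hMh hP c hρ hw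
    have h2 := lev_le_of_dist_le_At hMh hP c hρ hw
    have hne := hdown w hw
    constructor <;> omega

/-- **THE `ρ`-BALL IS `w`-DEEP WHEN `ρ + w` FITS UNDER THE `t₀`-CENTRE BOUNDS**: `ρ + w ≤ t₀S_k + S_j/2` (below) and `ρ + w ≤ (P_μ − t₀ − 1)S_k + S_j/2` (above).
[cite: Balaban1984PropagatorsII, (2.36) p.229 with (2.46) p.231, dictionary (charts)] -/
theorem siteDeep_of_dist_le_of_room_At (hMh : 1 ≤ Mh) {t₀ : ℕ} (hP : ∀ μ, t₀ + 1 ≤ P μ) (c : ↥(cubes D.toDomains)) {ρ : ℝ} {w : ℤ}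
    (hlo : ρ + (w : ℝ) ≤ (t₀ : ℝ) * (bigSide ℓ Mh k : ℝ) + (bigSide ℓ Mh c.1.1 : ℝ) / 2)
    (hhi : ∀ μ, ρ + (w : ℝ) ≤ ((P μ : ℝ) - t₀ - 1) * (bigSide ℓ Mh k : ℝ) + (bigSide ℓ Mh c.1.1 : ℝ) / 2)
    {x : ↥(boxDom (N0 ℓ Mh k P))} (h : dist (toR x.1) (ctr (DchAt D t₀ c) (ccAt D hMh hP c)) ≤ ρ) :
    SiteDeep (N0 ℓ Mh k P) w x.1 := by
  intro μ
  obtain ⟨h1, h2⟩ := ctr_ccAt_bounds hMh hP c μ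
  have hμ := (dist_le_pi_dist (toR x.1) _ μ).trans h
  rw [Real.dist_eq, abs_le] at hμ
  have ex : toR x.1 μ = (x.1 μ : ℝ) := rfl
  rw [ex] at hμ
  have hhiμ := hhi μ
  have hlo' : ((w : ℤ) : ℝ) ≤ ((x.1 μ : ℤ) : ℝ) := by linarith [hμ.1]
  have hhi' : ((x.1 μ + w : ℤ) : ℝ) ≤ (((N0 ℓ Mh k P μ : ℕ) : ℤ) : ℝ) := by
    rw [Int.cast_add, Int.cast_natCast]; linarith [hμ.2]
  exact ⟨Int.cast_le.1 hlo', Int.cast_le.1 hhi'⟩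

/-- **A BLOCK WHOSE SITES LIE IN THE BALL IS `w`-DEEP** under the same room hypotheses (`t₀`-chart). [cite: Balaban1984PropagatorsII, (2.45) p.231, dictionary (charts)] -/
theorem blkDeep_of_room_At (hMh : 1 ≤ Mh) {t₀ : ℕ} (hP : ∀ μ, t₀ + 1 ≤ P μ) (c : ↥(cubes D.toDomains)) {ρ : ℝ} {w : ℤ}
    (hlo : ρ + (w : ℝ) ≤ (t₀ : ℝ) * (bigSide ℓ Mh k : ℝ) + (bigSide ℓ Mh c.1.1 : ℝ) / 2)
    (hhi : ∀ μ, ρ + (w : ℝ) ≤ ((P μ : ℝ) - t₀ - 1) * (bigSide ℓ Mh k : ℝ) + (bigSide ℓ Mh c.1.1 : ℝ) / 2)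
    {b : ↥(bset (DchAt D t₀ c))}
    (hb : ∀ x : ↥(boxDom (N0 ℓ Mh k P)), blkOf (DchAt D t₀ c) x = b → dist (toR x.1) (ctr (DchAt D t₀ c) (ccAt D hMh hP c)) ≤ ρ) :
    BlkDeep (DchAt D t₀ c) w b :=
  fun x hx => siteDeep_of_dist_le_of_room_At hMh hP c hlo hhi (hb x hx)

end Window

end Literature.MathematicalPhysics.QuantumFieldTheory.Balaban1983to89.B6Partition118KLevelTorusCentralAtL0
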